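import Summits.BirchSwinnertonDyer.BirchSwinnertonDyer.Theorems.BiquadraticEisensteinDescentHeegnerTwistCouplingInSupplySqrtTwoWindow
import Mathlib.NumberTheory.SumTwoSquares
import HarnessLib

set_option linter.dupNamespace false -- `Summit.BirchSwinnertonDyer.BirchSwinnertonDyer.Theorems.…` (summit = sub)
set_option autoImplicit false

/-!
# Crux `HeegnerTwistCouplingInSupply` (stmt-BirchSwinnertonDyer-21381) — the `j = 8000` corner on `p ≡ 5 (mod 8)`: the FERMAT PIN
# (a universal `(5,−)`-partner `q₀ < 5p`) and the rounding trichotomy of `√(p/2)` ⇒ a cell pair with `|d| = O(p^{3/2})` for EVERY prime `p ≡ 5 (mod 8)`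

Route `BiquadraticEisensteinDescent` (cell `pub/bsd-wall`, width seat `bsd-wall-cm-bed-w2` g13; `--supports` 21381, helper). The CELL-5 corner of
`W = B_p = ⟨0, 4p, 0, 2p², 0⟩` (`j = 8000`, CM by `ℤ[√−2]`, w1 g10) needs primes `ℓ ≡ 3 (mod 8)` and `q₀ ≡ 5 (mod 8)`, BOTH non-residues mod `p`,
with `h(−ℓq₀) < p`; the `(3,−)` prime is universally pinned (`pinThreeMinus_of_mod_eight_eq_five`, `ℓ < p`), the `(5,−)` prime was not
(SQRT2-CORNER-w1g10 §3: «needs one analytic input — a small non-residue partner `≡ 5 (8)`»; thirteen fixed-partner rungs, residual `2⁻¹³`).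
THE FERMAT PIN (§1): write `p = x² + y²` (Fermat; `p ≡ 5 (mod 8)`); then `N = x² + (3y)² = p + 8y² ≡ 5 (mod 8)` is a sum of two squares, so it
has a prime factor `q₀ ≡ 5 (mod 8)` (`exists_prime_dvd_mod_eight_eq_five`: primes `≡ 3 (mod 4)` divide `x² + y²` to even powers); `q₀ ∤ y`
(else `q₀ = p ∣ y`), so `8y² ≡ −p (mod q₀)` gives `(p/q₀) = (−2/q₀) = −1`, i.e. `(q₀/p) = −1`; tripling the smaller square, `q₀ < 5p`. Alone this is
too big (`|d| = ℓq₀ = O(p²)`), but together with the rounding of `√(p/2)` (`…SqrtTwoWindow.roundingNonresidue`: the even neighbours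
`w < √(p/2) < w + 2`, `M⁻ = p − 2w² ≡ 5`, `M⁺ = 2(w+2)² − p ≡ 3 (mod 8)`, every `±3`-factor a non-residue) the TRICHOTOMY (§3) gives
`|d| = O(p^{3/2})` in every branch: (α) a `3`- and a `5`-type factor both occur in `M⁺M⁻`: `ℓq₀ ≤ 16(s+1)²`; (β) no `5`-type factor: `M⁻ ≡ 5`
forces `3`- and `7`-type factors, `7ℓ ≤ M⁻ ≤ 8s + 5`, and `q₀ < 5p` is the Fermat pin; (γ) no `3`-type factor: `7q₀ ≤ M⁺ ≤ 8s + 3` and `ℓ < p`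
(`s = ⌊√(p/2)⌋`). Hence ★ `exists_cellPair_bound_five`: `7·ℓq₀ ≤ 5p(8s + 5)` for EVERY prime `p ≡ 5 (mod 8)`, `p ≥ 100` — inside the reach of
the class-number-formula lever (sequel `…SqrtTwoAllFiveCellData`: `p ≥ 11100` analytic, kernel table below; then the corner for ALL `p ≡ 5 (mod 8)`).

Elementary number theory only (no named fact, no definition); nothing about the crux (all CM `W`; residual C⁺), `L`-values or BSD is asserted —
BSD is not proved by any of this. Supports stmt-BirchSwinnertonDyer-21381.
-/

namespace Summit.BirchSwinnertonDyer.BirchSwinnertonDyer.Theorems.BiquadraticEisensteinDescentHeegnerTwistCouplingInSupplySqrtTwoFermatPin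

open Literature.NumberTheory.EllipticCurves.HeathBrown1994.Families (jacobiSym_two_eq_neg_one)
open Summit.BirchSwinnertonDyer.BirchSwinnertonDyer.Theorems.BiquadraticEisensteinDescentHeegnerTwistCouplingInSupplyThreeSquaresPin
  (exists_prime_dvd_mod_eight_eq_five)
open Summit.BirchSwinnertonDyer.BirchSwinnertonDyer.Theorems.BiquadraticEisensteinDescentHeegnerTwistCouplingInSupplyRoundingPin
  (exists_prime_dvd_mod_eight_three_or_five exists_prime_dvd_three_and_seven exists_prime_dvd_five_and_seven seven_mul_le_of_dvd_of_dvd)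
open Summit.BirchSwinnertonDyer.BirchSwinnertonDyer.Theorems.BiquadraticEisensteinDescentHeegnerTwistCouplingInSupplySqrtTwoWindow
  (jacobiSym_eq_neg_one_of_dvd_sub_two_mul_sq)
open Summit.BirchSwinnertonDyer.BirchSwinnertonDyer.Theorems.BiquadraticEisensteinDescentHeegnerTwistCouplingInSupplySqrtTwoPin
  (pinThreeMinus_of_mod_eight_eq_five)

/-! ## §1 The Fermat pin: a `(5,−)`-partner `q₀ < 5p` for every prime `p ≡ 5 (mod 8)` -/

/-- **`(q₀/p) = −1` for a prime factor `q₀ ≡ 5 (mod 8)` of `p + 2w²`**, `p` prime, `0 < w < p`: `q₀ ∤ w` (else `q₀ ∣ p`, `q₀ = p ∣ w`), so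
`p ≡ −2w² (mod q₀)` gives `(p/q₀) = (−2/q₀) = −1` (`q₀ ≡ 5 (mod 8)`), and `(q₀/p) = (p/q₀)` as `q₀ ≡ 1 (mod 4)`. [folklore] -/
theorem jacobiSym_eq_neg_one_of_dvd_add_two_mul_sq {p q w N : ℕ} (hp : p.Prime) (hp2 : p % 2 = 1) (hq : q.Prime) (hq8 : q % 8 = 5)
    (hN : p + 2 * (w * w) = N) (hqN : q ∣ N) (hw0 : 0 < w) (hwp : w < p) : jacobiSym (q : ℤ) p = -1 := by
  have hqw : ¬ q ∣ w := by
    intro hqw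
    have hqp : q ∣ p := by
      have h2 : q ∣ 2 * (w * w) := (hqw.mul_left w).mul_left 2
      have h3 : q ∣ p + 2 * (w * w) := hN ▸ hqN
      exact (Nat.dvd_add_left h2).mp h3
    have : q = p := (Nat.prime_dvd_prime_iff_eq hq hp).mp hqp
    subst this
    exact absurd (Nat.le_of_dvd hw0 hqw) (not_le.mpr hwp)
  have hgcd : (w : ℤ).gcd q = 1 := by
    rw [Int.gcd_natCast_natCast]
    exact Nat.coprime_comm.mp ((Nat.Prime.coprime_iff_not_dvd hq).mpr hqw)
  have hsq : jacobiSym ((w : ℤ) ^ 2) q = 1 := jacobiSym.sq_one' hgcd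
  have hm2 : jacobiSym (-2) q = -1 := by
    rw [jacobiSym.at_neg_two (Nat.odd_iff.mpr (by omega)), ZMod.χ₈'_nat_eq_if_mod_eight, if_neg (by omega), if_neg (by omega)]
  have hmod : (p : ℤ) % (q : ℤ) = (-2 * (w : ℤ) ^ 2) % (q : ℤ) := by
    rw [Int.emod_eq_emod_iff_emod_sub_eq_zero]
    have : (p : ℤ) - -2 * (w : ℤ) ^ 2 = ((N : ℕ) : ℤ) := by rw [← hN]; push_cast; ring
    rw [this]
    exact Int.emod_eq_zero_of_dvd (Int.natCast_dvd_natCast.mpr hqN)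
  have hpq : jacobiSym (p : ℤ) q = -1 := by
    rw [jacobiSym.mod_left' hmod, jacobiSym.mul_left, hm2, hsq]
    norm_num
  rw [jacobiSym.quadratic_reciprocity_one_mod_four (by omega) (Nat.odd_iff.mpr hp2), hpq]

/-- ★ **THE FERMAT PIN.** For every prime `p ≡ 5 (mod 8)` there is a prime `q₀ ≡ 5 (mod 8)` with `(q₀/p) = −1` and `q₀ < 5p`: a prime factor
`≡ 5 (mod 8)` of `x² + (3y)² = p + 8y²`, where `p = x² + y²` (Fermat) and `y` is the smaller square root (`2y² < p`); `p` prime, `0 < w < p`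
in `jacobiSym_eq_neg_one_of_dvd_add_two_mul_sq` with `w = 2y`. [folklore] -/
theorem fermatPinFiveMinus {p : ℕ} (hp : p.Prime) (hp8 : p % 8 = 5) :
    ∃ q₀ : ℕ, q₀.Prime ∧ q₀ % 8 = 5 ∧ jacobiSym (q₀ : ℤ) p = -1 ∧ q₀ < 5 * p := by
  haveI : Fact p.Prime := ⟨hp⟩
  obtain ⟨a, b, hab⟩ := Nat.Prime.sq_add_sq (p := p) (by omega)
  -- order the two squares: `y` the smaller
  obtain ⟨x, y, hxy, hyx⟩ : ∃ x y : ℕ, x ^ 2 + y ^ 2 = p ∧ y ≤ x := by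
    rcases le_total b a with h | h
    · exact ⟨a, b, hab, h⟩
    · exact ⟨b, a, by rw [← hab]; ring, h⟩
  have hy0 : 0 < y := by
    rcases Nat.eq_zero_or_pos y with h | h
    · exfalso
      subst h
      simp only [ne_eq, OfNat.ofNat_ne_zero, not_false_eq_true, zero_pow, add_zero] at hxy
      have hx1 : x ∣ p := ⟨x, by rw [← hxy]; ring⟩
      rcases (Nat.dvd_prime hp).mp hx1 with h1 | h1
      · subst h1; simp at hxy; exact hp.one_lt.ne' hxy.symm
      · subst h1
        have := hp.two_le
        nlinarith
    · exact h
  have h2y : 2 * (y * y) < p := by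
    have : 2 * (y * y) ≤ p := by nlinarith
    rcases this.lt_or_eq with h | h
    · exact h
    · exfalso; omega
  have hyp : 2 * y < p := by nlinarith
  -- `N = x² + (3y)² = p + 8y² = p + 2(2y)²`
  obtain ⟨N, hN'⟩ : ∃ N, p + 8 * (y * y) = N := ⟨_, rfl⟩
  have hN : x ^ 2 + (3 * y) ^ 2 = N := by rw [← hN', ← hxy]; ring
  have hN'' : p + 2 * ((2 * y) * (2 * y)) = N := by rw [← hN']; ring
  have hN8 : N % 8 = 5 := by omega
  obtain ⟨q₀, hq₀, hq₀N, hq₀8⟩ := exists_prime_dvd_mod_eight_eq_five hN hN8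
  refine ⟨q₀, hq₀, hq₀8, jacobiSym_eq_neg_one_of_dvd_add_two_mul_sq hp (by omega) hq₀ hq₀8 hN'' hq₀N (by omega) hyp, ?_⟩
  have hNpos : 0 < N := by omega
  have := Nat.le_of_dvd hNpos hq₀N
  omega

/-! ## §2 The even neighbours of `√(p/2)` -/

/-- **The even neighbours of `√(p/2)`** (the data behind `…SqrtTwoWindow.roundingNonresidue`): for `p ≡ 5 (mod 8)`, `p ≥ 13`, an even
`w > 0` with `2w² < p < 2(w+2)²`, `M⁻ = p − 2w² ≡ 5`, `M⁺ = 2(w+2)² − p ≡ 3 (mod 8)`, `M⁺ + M⁻ = 8w + 8`, `w ≤ ⌊√(p/2)⌋`, `w + 2 < p`.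
[folklore] -/
theorem exists_even_neighbours {p : ℕ} (hp8 : p % 8 = 5) (h13 : 13 ≤ p) :
    ∃ w Mm Mp : ℕ, 2 * (w * w) + Mm = p ∧ p + Mp = 2 * ((w + 2) * (w + 2)) ∧ Mm % 8 = 5 ∧ Mp % 8 = 3 ∧ 0 < Mm ∧ 0 < Mp ∧
      Mm + Mp = 8 * w + 8 ∧ w ≤ Nat.sqrt (p / 2) ∧ 0 < w ∧ w + 2 < p := by
  obtain ⟨X, hX⟩ : ∃ X, X = p / 2 := ⟨_, rfl⟩
  obtain ⟨s, hs⟩ : ∃ s, s = Nat.sqrt X := ⟨_, rfl⟩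
  have hs1 : s * s ≤ X := hs ▸ Nat.sqrt_le X
  have hs2 : X < (s + 1) * (s + 1) := hs ▸ Nat.lt_succ_sqrt X
  have hpX : p = 2 * X + 1 := by omega
  have hs3 : 2 ≤ s := by
    by_contra h
    have : (s + 1) * (s + 1) ≤ 2 * 2 := Nat.mul_le_mul (by omega) (by omega)
    omega
  obtain ⟨w, hw2, hws, hsw⟩ : ∃ w : ℕ, w % 2 = 0 ∧ w ≤ s ∧ s ≤ w + 1 := by
    by_cases heven : s % 2 = 0
    · exact ⟨s, heven, le_rfl, by omega⟩
    · exact ⟨s - 1, by omega, by omega, by omega⟩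
  have hw1 : 1 ≤ w := by omega
  have hww : 2 * (w * w) < p := by nlinarith [Nat.mul_le_mul hws hws]
  have hww2 : p < 2 * ((w + 2) * (w + 2)) := by
    nlinarith [Nat.mul_le_mul (show s + 1 ≤ w + 2 by omega) (show s + 1 ≤ w + 2 by omega)]
  obtain ⟨Mm, hMm⟩ : ∃ Mm : ℕ, 2 * (w * w) + Mm = p := ⟨p - 2 * (w * w), by omega⟩
  obtain ⟨Mp, hMp⟩ : ∃ Mp : ℕ, p + Mp = 2 * ((w + 2) * (w + 2)) := ⟨2 * ((w + 2) * (w + 2)) - p, by omega⟩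
  obtain ⟨k, hk⟩ : ∃ k, w = 2 * k := ⟨w / 2, by omega⟩
  have h8a : 2 * (w * w) % 8 = 0 := by rw [hk, show 2 * (2 * k * (2 * k)) = 8 * (k * k) by ring]; simp
  have h8b : 2 * ((w + 2) * (w + 2)) % 8 = 0 := by
    rw [hk, show 2 * ((2 * k + 2) * (2 * k + 2)) = 8 * ((k + 1) * (k + 1)) by ring]; simp
  have hwp : w + 2 < p := by
    by_contra h
    have h1 : (p - 2) * (p - 2) ≤ s * s := Nat.mul_self_le_mul_self (by omega)
    have h2 : 11 * (p - 2) ≤ (p - 2) * (p - 2) := Nat.mul_le_mul_right _ (by omega)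
    omega
  refine ⟨w, Mm, Mp, hMm, hMp, by omega, by omega, by omega, by omega, by nlinarith, ?_, by omega, hwp⟩
  rw [← hX, ← hs]; exact hws

/-! ## §3 ★ The rounding trichotomy on `p ≡ 5 (mod 8)` -/

/-- ★ **THE ROUNDING TRICHOTOMY on `p ≡ 5 (mod 8)`.** For a prime `p ≡ 5 (mod 8)`, `p ≥ 13`, with `s = ⌊√(p/2)⌋`: EITHER a `(3,−)`-partner `ℓ`
and a `(5,−)`-partner `q₀` with `ℓq₀ ≤ 16(s+1)²` (both types among the prime factors of `M⁺M⁻`), OR a `(3,−)`-partner `ℓ` with `7ℓ ≤ 8s + 5`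
(no `5`-type factor: `M⁻ ≡ 5 (mod 8)` has factors `≡ 3` and `≡ 7`), OR a `(5,−)`-partner `q₀` with `7q₀ ≤ 8s + 3` (no `3`-type factor:
`M⁺ ≡ 3 (mod 8)` has factors `≡ 5` and `≡ 7`). [folklore] -/
theorem roundingTrichotomy_five {p : ℕ} (hp : p.Prime) (hp8 : p % 8 = 5) (h13 : 13 ≤ p) :
    (∃ l q₀ : ℕ, l.Prime ∧ l % 8 = 3 ∧ jacobiSym (l : ℤ) p = -1 ∧ q₀.Prime ∧ q₀ % 8 = 5 ∧ jacobiSym (q₀ : ℤ) p = -1 ∧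
        l * q₀ ≤ 16 * (Nat.sqrt (p / 2) + 1) ^ 2) ∨
      (∃ l : ℕ, l.Prime ∧ l % 8 = 3 ∧ jacobiSym (l : ℤ) p = -1 ∧ 7 * l ≤ 8 * Nat.sqrt (p / 2) + 5) ∨
      (∃ q₀ : ℕ, q₀.Prime ∧ q₀ % 8 = 5 ∧ jacobiSym (q₀ : ℤ) p = -1 ∧ 7 * q₀ ≤ 8 * Nat.sqrt (p / 2) + 3) := by
  obtain ⟨w, Mm, Mp, hMm, hMp, hMm8, hMp8, hMm0, hMp0, hsum, hws, hw0, hwp⟩ := exists_even_neighbours hp8 h13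
  set s := Nat.sqrt (p / 2) with hs
  -- every `±3`-factor of `M⁻` or `M⁺` is a non-residue
  have sym : ∀ r : ℕ, r.Prime → (r ∣ Mm ∨ r ∣ Mp) → (r % 8 = 3 ∨ r % 8 = 5) → jacobiSym (r : ℤ) p = -1 := by
    intro r hr hrM hr8
    rcases hrM with h | h
    · exact jacobiSym_eq_neg_one_of_dvd_sub_two_mul_sq hp (by omega) hr hr8 (Or.inl hMm) h hw0 (by omega)
    · exact jacobiSym_eq_neg_one_of_dvd_sub_two_mul_sq (w := w + 2) hp (by omega) hr hr8 (Or.inr hMp) h (by omega) hwp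
  have hprod : Mm * Mp ≤ 16 * (s + 1) ^ 2 := by
    have h1 : 4 * (Mm * Mp) ≤ (Mm + Mp) * (Mm + Mp) := by nlinarith [sq_nonneg ((Mm : ℤ) - (Mp : ℤ))]
    rw [hsum] at h1
    have h2 : (8 * w + 8) * (8 * w + 8) ≤ (8 * s + 8) * (8 * s + 8) := Nat.mul_self_le_mul_self (by omega)
    nlinarith
  by_cases h5 : ∃ q : ℕ, q.Prime ∧ (q ∣ Mm ∨ q ∣ Mp) ∧ q % 8 = 5
  · by_cases h3 : ∃ l : ℕ, l.Prime ∧ (l ∣ Mm ∨ l ∣ Mp) ∧ l % 8 = 3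
    · left
      obtain ⟨q, hq, hqM, hq8⟩ := h5
      obtain ⟨l, hl, hlM, hl8⟩ := h3
      have hlq : l ≠ q := by rintro rfl; omega
      have hcop : Nat.Coprime l q := (Nat.coprime_primes hl hq).mpr hlq
      refine ⟨l, q, hl, hl8, sym l hl hlM (Or.inl hl8), hq, hq8, sym q hq hqM (Or.inr hq8), ?_⟩
      rcases hlM with hl' | hl' <;> rcases hqM with hq' | hq'
      · calc l * q ≤ Mm := Nat.le_of_dvd hMm0 (hcop.mul_dvd_of_dvd_of_dvd hl' hq')
          _ ≤ Mm * Mp := Nat.le_mul_of_pos_right _ hMp0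
          _ ≤ _ := hprod
      · calc l * q ≤ Mm * Mp := Nat.mul_le_mul (Nat.le_of_dvd hMm0 hl') (Nat.le_of_dvd hMp0 hq')
          _ ≤ _ := hprod
      · calc l * q ≤ Mp * Mm := Nat.mul_le_mul (Nat.le_of_dvd hMp0 hl') (Nat.le_of_dvd hMm0 hq')
          _ = Mm * Mp := Nat.mul_comm _ _
          _ ≤ _ := hprod
      · calc l * q ≤ Mp := Nat.le_of_dvd hMp0 (hcop.mul_dvd_of_dvd_of_dvd hl' hq')
          _ ≤ Mm * Mp := Nat.le_mul_of_pos_left _ hMm0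
          _ ≤ _ := hprod
    · -- no `3`-type factor: `M⁺ ≡ 3 (mod 8)` has a `5`- and a `7`-type factor
      right; right
      push Not at h3
      obtain ⟨q, s', hq, hqM, hq8, hs', hs'M, hs'8⟩ :=
        exists_prime_dvd_five_and_seven hMp8 fun r hr hrM hr8 => h3 r hr (Or.inr hrM) hr8
      refine ⟨q, hq, hq8, sym q hq (Or.inr hqM) (Or.inr hq8), ?_⟩
      have h7 := seven_mul_le_of_dvd_of_dvd hMp0 hq hs' (by rintro rfl; omega) (by have := hs'.two_le; omega) hqM hs'M
      omega
  · -- no `5`-type factor: `M⁻ ≡ 5 (mod 8)` has a `3`- and a `7`-type factor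
    right; left
    push Not at h5
    obtain ⟨l, s', hl, hlM, hl8, hs', hs'M, hs'8⟩ :=
      exists_prime_dvd_three_and_seven hMm8 fun r hr hrM hr8 => h5 r hr (Or.inl hrM) hr8
    refine ⟨l, hl, hl8, sym l hl (Or.inl hlM) (Or.inl hl8), ?_⟩
    have h7 := seven_mul_le_of_dvd_of_dvd hMm0 hl hs' (by rintro rfl; omega) (by have := hs'.two_le; omega) hlM hs'M
    omega

/-! ## §4 ★ The cell pair with `|d| = ℓq₀ = O(p^{3/2})` for EVERY prime `p ≡ 5 (mod 8)` -/

/-- ★ **CELL PAIR FOR EVERY PRIME `p ≡ 5 (mod 8)`, `p ≥ 100`**: primes `ℓ ≡ 3 (mod 8)`, `q₀ ≡ 5 (mod 8)`, both with Jacobi symbol `−1` at `p`,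
such that `7·ℓq₀ ≤ 5p(8s + 5)`, `s = ⌊√(p/2)⌋` (so `ℓq₀ < 4.1·p^{3/2}`). Trichotomy + Fermat pin (`q₀ < 5p`) + `pinThreeMinus_of_mod_eight_eq_five`
(`ℓ < p`). [folklore] -/
theorem exists_cellPair_bound_five {p : ℕ} (hp : p.Prime) (hp8 : p % 8 = 5) (h100 : 100 ≤ p) :
    ∃ l q₀ : ℕ, l.Prime ∧ l % 8 = 3 ∧ q₀.Prime ∧ q₀ % 8 = 5 ∧ jacobiSym (l : ℤ) p = -1 ∧ jacobiSym (q₀ : ℤ) p = -1 ∧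
      7 * (l * q₀) ≤ 5 * p * (8 * Nat.sqrt (p / 2) + 5) := by
  obtain ⟨s, hs⟩ : ∃ s, s = Nat.sqrt (p / 2) := ⟨_, rfl⟩
  have hs1 : s * s ≤ p / 2 := hs ▸ Nat.sqrt_le (p / 2)
  have hs2 : p / 2 < (s + 1) * (s + 1) := hs ▸ Nat.lt_succ_sqrt (p / 2)
  have hs7 : 7 ≤ s := by
    by_contra h
    have : (s + 1) * (s + 1) ≤ 7 * 7 := Nat.mul_le_mul (by omega) (by omega)
    omega
  have h2s : 2 * (s * s) ≤ p := by omega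
  rw [← hs]
  rcases roundingTrichotomy_five hp hp8 (by omega) with ⟨l, q₀, hl, hl8, hJl, hq₀, hq₀8, hJq, hle⟩ | ⟨l, hl, hl8, hJl, hle⟩ |
      ⟨q₀, hq₀, hq₀8, hJq, hle⟩
  · refine ⟨l, q₀, hl, hl8, hq₀, hq₀8, hJl, hJq, ?_⟩
    rw [← hs] at hle
    have hss : 7 * s ≤ s * s := Nat.mul_le_mul_right s hs7
    nlinarith
  · obtain ⟨q₀, hq₀, hq₀8, hJq, hq₀lt⟩ := fermatPinFiveMinus hp hp8
    refine ⟨l, q₀, hl, hl8, hq₀, hq₀8, hJl, hJq, ?_⟩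
    rw [← hs] at hle
    calc 7 * (l * q₀) = (7 * l) * q₀ := by ring
      _ ≤ (8 * s + 5) * (5 * p) := Nat.mul_le_mul hle hq₀lt.le
      _ = 5 * p * (8 * s + 5) := by ring
  · obtain ⟨l, hl, hlp, hl8, hJl⟩ := pinThreeMinus_of_mod_eight_eq_five p hp hp8
    refine ⟨l, q₀, hl, hl8, hq₀, hq₀8, hJl, hJq, ?_⟩
    rw [← hs] at hle
    calc 7 * (l * q₀) = l * (7 * q₀) := by ring
      _ ≤ (5 * p) * (8 * s + 5) := Nat.mul_le_mul (by omega) (by omega)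
      _ = 5 * p * (8 * s + 5) := by ring

end Summit.BirchSwinnertonDyer.BirchSwinnertonDyer.Theorems.BiquadraticEisensteinDescentHeegnerTwistCouplingInSupplySqrtTwoFermatPin
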